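import Mathlib
import HarnessLib
import Summits.RiemannHypothesis.RiemannHypothesis.Theorems.LiAsymptoticSmoothCuts

/-!
# Far Log-Kernel Tail Bound

This file proves the upper tail bound for the log-kernel integrand.

## Main Result

* `upper_tail_bound`: For M ≥ 2, |∫_M^∞ log v/(1-v²)| ≤ 2(log M + 1)/M.
  Uses `integral_log_div_sq` and the comparison v²-1 ≥ v²/2 for v ≥ 2.

## References

Supports stub_farLogKernelSharp for stmt-RiemannHypothesis-24730 (Remainder0Xi crux).
-/

set_option linter.dupNamespace false
namespace Summit.RiemannHypothesis.RiemannHypothesis.Theorems.EarlyAppointmentsRemainder0Xi.FarKernel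

open scoped BigOperators Topology Classical
open Real Complex MeasureTheory Set Filter
open Summit.RiemannHypothesis.RiemannHypothesis.Theorems.LiTheory.SmoothCuts

/-- For M ≥ 2, the upper tail (M, ∞) contributes at most 2(log M + 1)/M.

**Proof**: For v ≥ M ≥ 2, we have v² - 1 ≥ v²/2, so |log v/(1-v²)| ≤ 2 log v/v².
Using `integral_log_div_sq` (∫_M^∞ log v/v² = (log M + 1)/M), we get the bound 2(log M + 1)/M. -/
lemma upper_tail_bound {M : ℝ} (hM : 2 ≤ M) :
    |∫ v in Ioi M, Real.log v / (1 - v ^ 2)| ≤ 2 * (Real.log M + 1) / M := by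
  have hM1 : 1 ≤ M := by linarith
  have hMpos : 0 < M := by linarith
  -- The integrand is negative for v > 1
  have h_neg : ∀ v ∈ Ioi M, Real.log v / (1 - v ^ 2) ≤ 0 := fun v hv => by
    apply div_nonpos_of_nonneg_of_nonpos
    · exact Real.log_nonneg (by linarith [mem_Ioi.1 hv])
    · have hv2 : 1 < v ^ 2 := by nlinarith [mem_Ioi.1 hv, hM]
      linarith
  have h_abs : |∫ v in Ioi M, Real.log v / (1 - v ^ 2)| = -(∫ v in Ioi M, Real.log v / (1 - v ^ 2)) := by
    rw [abs_of_nonpos]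
    apply setIntegral_nonpos measurableSet_Ioi h_neg
  rw [h_abs, ← integral_neg]
  -- Now -(log v / (1 - v²)) = log v / (v² - 1)
  have h_eq : ∀ v ∈ Ioi M, -(Real.log v / (1 - v ^ 2)) = Real.log v / (v ^ 2 - 1) := fun v hv => by
    have h1 : 1 - v ^ 2 = -(v ^ 2 - 1) := by ring
    rw [h1, div_neg, neg_neg]
  simp_rw [setIntegral_congr_fun measurableSet_Ioi h_eq]
  -- For v ≥ 2: v² - 1 ≥ v²/2, so log v / (v² - 1) ≤ 2 log v / v²
  have h_pt : ∀ v ∈ Ioi M, Real.log v / (v ^ 2 - 1) ≤ 2 * Real.log v / v ^ 2 := fun v hv => by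
    have hv' : M < v := mem_Ioi.1 hv
    have hv2 : 2 ≤ v := by linarith
    have hvsq : v ^ 2 / 2 ≤ v ^ 2 - 1 := by nlinarith
    have hvsq_half_pos : 0 < v ^ 2 / 2 := by positivity
    have hlog : 0 ≤ Real.log v := Real.log_nonneg (by linarith)
    calc Real.log v / (v ^ 2 - 1)
        ≤ Real.log v / (v ^ 2 / 2) := div_le_div_of_nonneg_left hlog hvsq_half_pos hvsq
      _ = 2 * Real.log v / v ^ 2 := by field_simp
  -- Use integral_log_div_sq: ∫ log t/t² = (log M + 1)/M
  obtain ⟨hint, hval⟩ := integral_log_div_sq hM1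
  -- Integrability of 2 * log v / v² = 2 * (log v / v²)
  have hint2 : IntegrableOn (fun v => 2 * Real.log v / v ^ 2) (Ioi M) := by
    have : (fun v => 2 * Real.log v / v ^ 2) = (fun v => (2 : ℝ) • (Real.log v / v ^ 2)) := by
      ext v; simp [smul_eq_mul]; ring
    rw [this]; exact hint.smul (2 : ℝ)
  -- Positivity
  have h_pos : ∀ v ∈ Ioi M, 0 ≤ Real.log v / (v ^ 2 - 1) := fun v hv => by
    exact div_nonneg (Real.log_nonneg (by linarith [mem_Ioi.1 hv])) (by nlinarith [mem_Ioi.1 hv])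
  have h_pos2 : ∀ v ∈ Ioi M, 0 ≤ 2 * Real.log v / v ^ 2 := fun v hv => by
    exact div_nonneg (mul_nonneg (by norm_num) (Real.log_nonneg (by linarith [mem_Ioi.1 hv]))) (sq_nonneg v)
  -- Integrability of log v / (v² - 1) via comparison
  have hint_orig : IntegrableOn (fun v => Real.log v / (v ^ 2 - 1)) (Ioi M) := by
    refine Integrable.mono' hint2 ?_ ?_
    · exact (Real.measurable_log.div ((measurable_id.pow_const 2).sub_const 1)).aestronglyMeasurable
    · filter_upwards [ae_restrict_mem measurableSet_Ioi] with v hv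
      calc ‖Real.log v / (v ^ 2 - 1)‖ = |Real.log v / (v ^ 2 - 1)| := Real.norm_eq_abs _
        _ = Real.log v / (v ^ 2 - 1) := abs_of_nonneg (h_pos v hv)
        _ ≤ 2 * Real.log v / v ^ 2 := h_pt v hv
  -- Integral value: ∫ 2*(log v/v²) = 2 * (log M + 1)/M
  have hval2 : ∫ v in Ioi M, 2 * Real.log v / v ^ 2 = 2 * (Real.log M + 1) / M := by
    have h1 : (fun v => 2 * Real.log v / v ^ 2) = (fun v => (2 : ℝ) • (Real.log v / v ^ 2)) := by
      ext v; simp [smul_eq_mul]; ring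
    rw [h1, integral_smul, hval]; ring
  -- Comparison
  calc ∫ v in Ioi M, Real.log v / (v ^ 2 - 1)
      ≤ ∫ v in Ioi M, 2 * Real.log v / v ^ 2 := setIntegral_mono_on hint_orig hint2 measurableSet_Ioi h_pt
    _ = 2 * (Real.log M + 1) / M := hval2

end Summit.RiemannHypothesis.RiemannHypothesis.Theorems.EarlyAppointmentsRemainder0Xi.FarKernel
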